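import Summits.QuantumFields.BalabanUV.Beta.GAN24.SymContactFaceJumpCommutator
import Summits.QuantumFields.BalabanUV.Beta.GAN24.ContactFaceJumpBorder

/-!
# `GAN24.SymContactFaceJumpBorder` — the TIP ∕ ROOT weights of the border cells against an1's symmetrised count `symLinCountAt`: face-jump letters, vanishing products and the
# tip ∕ root commutators — the sym twin of leaf-01 g60's (E) `GAN24.ContactFaceJumpBorder` over leaf-01 g90's `SymContactFaceJump ∕ SymContactFaceJumpCommutator`

NOT IN PRINT — OUR BOOKKEEPING (OWNER `b2b-balaban-gan24-p1` gen 55, 2026-08-28; row G-an2-4 ∕ (CONV-C), TRANSFER-III, the (III′) S-slot (b), born-V contact letters `hCv ∕ hPcV`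
of road-P2 M.104 — TABLE HALF at an1's (0.4)-SYMMETRISED border table `symVhSAt ρ` and (0.4) packed first-order kernel `linSym04At ρ L` (the OWNER's memo `HCV-DESIGN-g55.md` §1∕§2):
a mkroot-style token re-run of the (E) file named below with `vhSAt ρ ↦ symVhSAt ρ`, `linSymAt ↦ linSym04At`, `linKerAt ∕ linCountAt ∕ linAvgAt ↦ symLinKerAt ∕ symLinCountAt ∕ symLinAvgAt`
(an1's `SymAveragingHessianCounts`, d1's `SymmetrisedAxialPotential`), the `q¹`-pairing normalisation `(L^{d+1})⁻¹ ↦ ((d+1)!·L^{d+1})⁻¹` (leaf-02 g55 `SymLinKernelExpansion.tsum_sum_symLinKerAt_mul`)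
and the count constant `L^{d+1}·ℓ ↦ (d+1)!·(L^{d+1}·ℓ)` (an1's `abs_symLinCountAt_le`, leaf-01 g90's `SymContactFaceJumpCommutator.sum_abs_symLinCountAt_le`) carried VERBATIM through every
statement; every TABLE-FREE lemma of the (E) files is consumed BY NAME (not copied), and leaf-01 g90's `SymContactFaceJump ∕ SymContactFaceJumpCommutator` supply the shared sym
count ∕ commutator letters.  [folklore] bookkeeping; 0 `def`, 0 cited fact, 0 `def … : Prop`, 0 sorry; NO estimate of Bałaban's beyond an1's DEFINED kernels.
HONEST FRAMING (cell contract, verbatim): «discharging `BetaPertH` makes Bałaban's UV stability UNCONDITIONAL — a real constructive-QFT result; it is NOT the continuum limit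
and NOT the Clay problem.»  HONEST DEPENDENCY (verbatim): «continuum YM on T⁴ ⇐ BetaPertH ∧ nine spine estimates (0/9 proved); BetaPertH ⇐ (D1) ∧ (D4) ∧ CAP+tail; G-an2-4
gates asym, D1 and NE2/3/4.»  Discharges NO letter of M.104 ∕ of the OWNER's END `CombChargeRowsOfBornContactLetters` (hCv ∕ hPcV stay HYPOTHESES); NEVER «G-an2-4 closed» as
(CONV-C); NOT D1, NOT BetaPertH, NOT continuum, NOT Clay.  2026-08-28; no existing file touched.

## What (same statements as the (E) file under the substitutions above; `Sym…` namespace)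
`abs_tipWeight_mul_symLinCountAt_le`, `abs_rootWeight_mul_symLinCountAt_le`, `abs_tipWeight_mul_symLinKerAt_le`, `abs_rootWeight_mul_symLinKerAt_le`, `tipWeight_mul_dz_mul_symLinCountAt_eq_zero`, `abs_tipWeight_staircase_mul_symLinCountAt_le`, `abs_rootWeight_staircase_mul_symLinCountAt_le`, `tipCommutator_eq_sum`, `rootCommutator_eq_sum`, `abs_tipCommutator_le_of_staircase_of_le`, `abs_rootCommutator_le_of_staircase_of_le`.
-/

noncomputable section

open Summit.QuantumFields.BalabanUV.Beta.GAN24.ContactFaceJumpBorder (abs_tipSite_le abs_rootSite_le blk_apply_le_blk_add_unitVec_apply)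

open Finset
open scoped BigOperators
open Literature.MathematicalPhysics.QuantumFieldTheory
open Literature.MathematicalPhysics.QuantumFieldTheory.Balaban1983to89
open Literature.MathematicalPhysics.QuantumFieldTheory.Balaban1983to89.Beta
open AffineAveraging (Form0 Form1 Site box toSite unitVec unitVec_apply dz)
open AveragingContours (blk blk_block)
open Summit.QuantumFields.BalabanUV.Beta.LinearGaugeVH (nearBox mem_nearBox)
open Summit.QuantumFields.BalabanUV.Beta.GAN24.SymLinKernelExpansion (symLinAvgAt_eq_sum_symLinCountAt)
open Summit.QuantumFields.BalabanUV.Beta.SymAveragingHessianCounts (symLinCountAt symLinKerAt abs_symLinCountAt_le abs_symLinKerAt_le symLinCountAt_eq_zero symLinKerAt_eq_zero)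
open Summit.QuantumFields.BalabanUV.Beta.SymmetrisedAxialPotential (symLinAvgAt)
open Summit.QuantumFields.BalabanUV.Beta.GAN24.SymContactFaceJump (symLinCountAt_eq_zero_of_not_twoBlock symLinKerAt_eq_zero_of_not_twoBlock)
open Summit.QuantumFields.BalabanUV.Beta.GAN24.ContactFaceJump (blk_root blk_farRoot)
open Summit.QuantumFields.BalabanUV.Beta.GAN24.ContactFaceJumpStaircase (staircase_split abs_hplus_jump_le)

namespace Summit.QuantumFields.BalabanUV.Beta.GAN24.SymContactFaceJumpBorder

variable {d : ℕ} {L : ℕ} {r : Fin (d + 1) → ℕ}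

/-! ## §1 Block-constant gauge functions: the tip and root two-site weights are the one face jump -/

section BlockConstant



/-- NOT IN PRINT; OUR BOOKKEEPING.  **THE TIP WEIGHT OF THE BORDER CELL IS THE ONE FACE JUMP** (box root, `ψ = h ∘ blk L`, EVERY bond `(b,z)`):
`|(ψ(z+e_b) − ψ(L·y+ρ+L·e_μ))·symLinCountAt ρ L μ y (b,z)| ≤ |h(y+e_μ) − h y|·|symLinCountAt ρ L μ y (b,z)|`. -/
theorem abs_tipWeight_mul_symLinCountAt_le (hL : 1 ≤ L) (hr : r ∈ box (d + 1) L) {ψ : Site (d + 1) → ℝ} (h : Site (d + 1) → ℝ)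
    (hψ : ∀ u, ψ u = h (blk L u)) (μ : Fin (d + 1)) (y : Site (d + 1)) (b : Fin (d + 1)) (z : Site (d + 1)) :
    |(ψ (z + unitVec b) - ψ ((L : ℤ) • y + toSite r + (L : ℤ) • unitVec μ)) * (symLinCountAt (toSite r) L μ y (b, z) : ℝ)|
      ≤ |h (y + unitVec μ) - h y| * |(symLinCountAt (toSite r) L μ y (b, z) : ℝ)| := by
  simp only [hψ, blk_farRoot y μ hr]
  rw [abs_mul]
  by_cases hq : (blk L z = y ∨ blk L z = y + unitVec μ) ∧ (blk L (z + unitVec b) = y ∨ blk L (z + unitVec b) = y + unitVec μ)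
  · exact mul_le_mul_of_nonneg_right (abs_tipSite_le h hq.2) (abs_nonneg _)
  · rw [symLinCountAt_eq_zero_of_not_twoBlock (f := (b, z)) hL hr hq, Int.cast_zero, abs_zero, mul_zero, mul_zero]

/-- NOT IN PRINT; OUR BOOKKEEPING.  **THE ROOT WEIGHT OF THE BORDER CELL IS THE ONE FACE JUMP** (box root, `ψ = h ∘ blk L`, EVERY bond `(b,z)`):
`|(ψ(L·y+ρ) − ψ z)·symLinCountAt ρ L μ y (b,z)| ≤ |h(y+e_μ) − h y|·|symLinCountAt ρ L μ y (b,z)|`. -/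
theorem abs_rootWeight_mul_symLinCountAt_le (hL : 1 ≤ L) (hr : r ∈ box (d + 1) L) {ψ : Site (d + 1) → ℝ} (h : Site (d + 1) → ℝ)
    (hψ : ∀ u, ψ u = h (blk L u)) (μ : Fin (d + 1)) (y : Site (d + 1)) (b : Fin (d + 1)) (z : Site (d + 1)) :
    |(ψ ((L : ℤ) • y + toSite r) - ψ z) * (symLinCountAt (toSite r) L μ y (b, z) : ℝ)|
      ≤ |h (y + unitVec μ) - h y| * |(symLinCountAt (toSite r) L μ y (b, z) : ℝ)| := by
  simp only [hψ, blk_root y hr]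
  rw [abs_mul]
  by_cases hq : (blk L z = y ∨ blk L z = y + unitVec μ) ∧ (blk L (z + unitVec b) = y ∨ blk L (z + unitVec b) = y + unitVec μ)
  · exact mul_le_mul_of_nonneg_right (abs_rootSite_le h hq.1) (abs_nonneg _)
  · rw [symLinCountAt_eq_zero_of_not_twoBlock (f := (b, z)) hL hr hq, Int.cast_zero, abs_zero, mul_zero, mul_zero]

/-- [folklore] The `symLinKerAt` form of the tip letter. -/
theorem abs_tipWeight_mul_symLinKerAt_le (hL : 1 ≤ L) (hr : r ∈ box (d + 1) L) {ψ : Site (d + 1) → ℝ} (h : Site (d + 1) → ℝ)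
    (hψ : ∀ u, ψ u = h (blk L u)) (μ : Fin (d + 1)) (y : Site (d + 1)) (b : Fin (d + 1)) (z : Site (d + 1)) :
    |(ψ (z + unitVec b) - ψ ((L : ℤ) • y + toSite r + (L : ℤ) • unitVec μ)) * symLinKerAt (toSite r) L μ y (b, z)|
      ≤ |h (y + unitVec μ) - h y| * |symLinKerAt (toSite r) L μ y (b, z)| := by
  simp only [hψ, blk_farRoot y μ hr]
  rw [abs_mul]
  by_cases hq : (blk L z = y ∨ blk L z = y + unitVec μ) ∧ (blk L (z + unitVec b) = y ∨ blk L (z + unitVec b) = y + unitVec μ)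
  · exact mul_le_mul_of_nonneg_right (abs_tipSite_le h hq.2) (abs_nonneg _)
  · rw [symLinKerAt_eq_zero_of_not_twoBlock (f := (b, z)) hL hr hq, abs_zero, mul_zero, mul_zero]

/-- [folklore] The `symLinKerAt` form of the root letter. -/
theorem abs_rootWeight_mul_symLinKerAt_le (hL : 1 ≤ L) (hr : r ∈ box (d + 1) L) {ψ : Site (d + 1) → ℝ} (h : Site (d + 1) → ℝ)
    (hψ : ∀ u, ψ u = h (blk L u)) (μ : Fin (d + 1)) (y : Site (d + 1)) (b : Fin (d + 1)) (z : Site (d + 1)) :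
    |(ψ ((L : ℤ) • y + toSite r) - ψ z) * symLinKerAt (toSite r) L μ y (b, z)|
      ≤ |h (y + unitVec μ) - h y| * |symLinKerAt (toSite r) L μ y (b, z)| := by
  simp only [hψ, blk_root y hr]
  rw [abs_mul]
  by_cases hq : (blk L z = y ∨ blk L z = y + unitVec μ) ∧ (blk L (z + unitVec b) = y ∨ blk L (z + unitVec b) = y + unitVec μ)
  · exact mul_le_mul_of_nonneg_right (abs_rootSite_le h hq.1) (abs_nonneg _)
  · rw [symLinKerAt_eq_zero_of_not_twoBlock (f := (b, z)) hL hr hq, abs_zero, mul_zero, mul_zero]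


/-- NOT IN PRINT; OUR BOOKKEEPING.  **THE BORDER ΔΔ IDENTITY: THE TIP JUMP OF ONE BLOCK-CONSTANT FUNCTION NEVER MULTIPLIES THE GRADIENT OF ANOTHER on the support of `q¹,ρ`**
(box root, EVERY bond): `(h_a(blk(z+e_b)) − h_a(y+e_μ))·(h_b(blk(z+e_b)) − h_b(blk z))·count(b,z) = 0` for `ψ_a = h_a∘blk L`, `ψ_b = h_b∘blk L` — interior bond: difference `0`; crossing
bond: tip label `y+e_μ`, tip weight `0`; the «downward» crossing (base `y+e_μ`, tip `y`) is excluded by `blk_apply_le_blk_add_unitVec_apply`. -/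
theorem tipWeight_mul_dz_mul_symLinCountAt_eq_zero (hL : 1 ≤ L) (hr : r ∈ box (d + 1) L) {ψa ψb : Site (d + 1) → ℝ} (ha hb : Site (d + 1) → ℝ)
    (hψa : ∀ u, ψa u = ha (blk L u)) (hψb : ∀ u, ψb u = hb (blk L u)) (μ : Fin (d + 1)) (y : Site (d + 1)) (b : Fin (d + 1)) (z : Site (d + 1)) :
    (ψa (z + unitVec b) - ψa ((L : ℤ) • y + toSite r + (L : ℤ) • unitVec μ)) * (ψb (z + unitVec b) - ψb z)
        * (symLinCountAt (toSite r) L μ y (b, z) : ℝ) = 0 := by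
  simp only [hψa, hψb, blk_farRoot y μ hr]
  by_cases hq : (blk L z = y ∨ blk L z = y + unitVec μ) ∧ (blk L (z + unitVec b) = y ∨ blk L (z + unitVec b) = y + unitVec μ)
  · obtain ⟨hz | hz, hz' | hz'⟩ := hq
    · rw [hz, hz']; ring
    · rw [hz']; ring
    · -- downward crossing: impossible
      exfalso
      have hmono := blk_apply_le_blk_add_unitVec_apply hL z b μ
      rw [hz, hz', Pi.add_apply, unitVec_apply, if_pos rfl] at hmono
      omega
    · rw [hz, hz']; ring
  · rw [symLinCountAt_eq_zero_of_not_twoBlock (f := (b, z)) hL hr hq, Int.cast_zero, mul_zero]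

end BlockConstant

/-! ## §2 Staircases: the finest piece + the same crossed-scale letter `J(μ,y)` as the Λ half -/

section Staircase

variable {Lc : ℕ} {rr : Fin (d + 1) → ℕ}

/-- NOT IN PRINT; OUR BOOKKEEPING.  **THE TIP WEIGHT OF A STAIRCASE ON THE SUPPORT**: `|(ψ(z+e_b) − ψ(Lc·y+ρ+Lc·e_μ))·count| ≤ (|G 0 (z+e_b) − G 0 (Lc·y+ρ+Lc·e_μ)| + J(μ,y))·|count|`,
`J(μ,y) = Σ_{s<n} |G (s+1) (blk (Lc^s) (y+e_μ)) − G (s+1) (blk (Lc^s) y)|` (PART 2's letter). -/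
theorem abs_tipWeight_staircase_mul_symLinCountAt_le (hLc : 1 ≤ Lc) (hrr : rr ∈ box (d + 1) Lc) (G : ℕ → Site (d + 1) → ℝ) (n : ℕ)
    {ψ : Site (d + 1) → ℝ} (hψ : ∀ u, ψ u = ∑ s ∈ Finset.range (n + 1), G s (blk (Lc ^ s) u))
    (μ : Fin (d + 1)) (y : Site (d + 1)) (b : Fin (d + 1)) (z : Site (d + 1)) :
    |(ψ (z + unitVec b) - ψ ((Lc : ℤ) • y + toSite rr + (Lc : ℤ) • unitVec μ)) * (symLinCountAt (toSite rr) Lc μ y (b, z) : ℝ)|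
      ≤ (|G 0 (z + unitVec b) - G 0 ((Lc : ℤ) • y + toSite rr + (Lc : ℤ) • unitVec μ)|
          + ∑ s ∈ Finset.range n, |G (s + 1) (blk (Lc ^ s) (y + unitVec μ)) - G (s + 1) (blk (Lc ^ s) y)|)
        * |(symLinCountAt (toSite rr) Lc μ y (b, z) : ℝ)| := by
  set q : ℝ := (symLinCountAt (toSite rr) Lc μ y (b, z) : ℝ)
  set hp : Site (d + 1) → ℝ := fun y' => ∑ s ∈ Finset.range n, G (s + 1) (blk (Lc ^ s) y') with hhp
  have hψ' : ∀ u, ψ u = G 0 u + hp (blk Lc u) := fun u => by rw [hψ, staircase_split]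
  have e : (ψ (z + unitVec b) - ψ ((Lc : ℤ) • y + toSite rr + (Lc : ℤ) • unitVec μ)) * q
      = (G 0 (z + unitVec b) - G 0 ((Lc : ℤ) • y + toSite rr + (Lc : ℤ) • unitVec μ)) * q
        + ((fun u => hp (blk Lc u)) (z + unitVec b) - (fun u => hp (blk Lc u)) ((Lc : ℤ) • y + toSite rr + (Lc : ℤ) • unitVec μ)) * q := by
    simp only [hψ']; ring
  rw [e, add_mul]
  refine (abs_add_le _ _).trans (add_le_add (le_of_eq (abs_mul _ _)) ?_)
  refine (abs_tipWeight_mul_symLinCountAt_le hLc hrr hp (fun _ => rfl) μ y b z).trans (mul_le_mul_of_nonneg_right ?_ (abs_nonneg _))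
  rw [hhp]
  exact abs_hplus_jump_le G n μ y

/-- NOT IN PRINT; OUR BOOKKEEPING.  **THE ROOT WEIGHT OF A STAIRCASE ON THE SUPPORT**: `|(ψ(Lc·y+ρ) − ψ z)·count| ≤ (|G 0 (Lc·y+ρ) − G 0 z| + J(μ,y))·|count|`. -/
theorem abs_rootWeight_staircase_mul_symLinCountAt_le (hLc : 1 ≤ Lc) (hrr : rr ∈ box (d + 1) Lc) (G : ℕ → Site (d + 1) → ℝ) (n : ℕ)
    {ψ : Site (d + 1) → ℝ} (hψ : ∀ u, ψ u = ∑ s ∈ Finset.range (n + 1), G s (blk (Lc ^ s) u))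
    (μ : Fin (d + 1)) (y : Site (d + 1)) (b : Fin (d + 1)) (z : Site (d + 1)) :
    |(ψ ((Lc : ℤ) • y + toSite rr) - ψ z) * (symLinCountAt (toSite rr) Lc μ y (b, z) : ℝ)|
      ≤ (|G 0 ((Lc : ℤ) • y + toSite rr) - G 0 z|
          + ∑ s ∈ Finset.range n, |G (s + 1) (blk (Lc ^ s) (y + unitVec μ)) - G (s + 1) (blk (Lc ^ s) y)|)
        * |(symLinCountAt (toSite rr) Lc μ y (b, z) : ℝ)| := by
  set q : ℝ := (symLinCountAt (toSite rr) Lc μ y (b, z) : ℝ)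
  set hp : Site (d + 1) → ℝ := fun y' => ∑ s ∈ Finset.range n, G (s + 1) (blk (Lc ^ s) y') with hhp
  have hψ' : ∀ u, ψ u = G 0 u + hp (blk Lc u) := fun u => by rw [hψ, staircase_split]
  have e : (ψ ((Lc : ℤ) • y + toSite rr) - ψ z) * q
      = (G 0 ((Lc : ℤ) • y + toSite rr) - G 0 z) * q
        + ((fun u => hp (blk Lc u)) ((Lc : ℤ) • y + toSite rr) - (fun u => hp (blk Lc u)) z) * q := by
    simp only [hψ']; ring
  rw [e, add_mul]
  refine (abs_add_le _ _).trans (add_le_add (le_of_eq (abs_mul _ _)) ?_)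
  refine (abs_rootWeight_mul_symLinCountAt_le hLc hrr hp (fun _ => rfl) μ y b z).trans (mul_le_mul_of_nonneg_right ?_ (abs_nonneg _))
  rw [hhp]
  exact abs_hplus_jump_le G n μ y

end Staircase

/-! ## §3 Commutator level: leaf-02 g48's TIP and ROOT two-site commutators, localised -/

section Commutator

variable {Lc : ℕ} {rr : Fin (d + 1) → ℕ}

/-- NOT IN PRINT; OUR BOOKKEEPING.  **THE TIP COMMUTATOR OVER BONDS**: `symLinAvgAt ρ (fun κ u ↦ ψ(u+e_κ)·T κ u) L μ y − ψ(L·y+ρ+L·e_μ)·symLinAvgAt ρ T L μ y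
= Σ_{x∈nearBox L y} Σ_α ((ψ(x+e_α) − ψ(L·y+ρ+L·e_μ))·count(α,x))·T α x`. -/
theorem tipCommutator_eq_sum (hr : r ∈ box (d + 1) L) (ψ : Site (d + 1) → ℝ) (T : Form1 (d + 1) ℝ) (μ : Fin (d + 1)) (y : Site (d + 1)) :
    symLinAvgAt (toSite r) (fun α x => ψ (x + unitVec α) * T α x) L μ y - ψ ((L : ℤ) • y + toSite r + (L : ℤ) • unitVec μ) * symLinAvgAt (toSite r) T L μ y
      = ∑ x ∈ nearBox L y, ∑ α, ((ψ (x + unitVec α) - ψ ((L : ℤ) • y + toSite r + (L : ℤ) • unitVec μ)) * (symLinCountAt (toSite r) L μ y (α, x) : ℝ)) * T α x := by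
  rw [symLinAvgAt_eq_sum_symLinCountAt hr, symLinAvgAt_eq_sum_symLinCountAt hr T, Finset.mul_sum, ← Finset.sum_sub_distrib]
  refine Finset.sum_congr rfl fun x _ => ?_
  rw [Finset.mul_sum, ← Finset.sum_sub_distrib]
  refine Finset.sum_congr rfl fun α _ => ?_
  ring

/-- NOT IN PRINT; OUR BOOKKEEPING.  **THE ROOT COMMUTATOR OVER BONDS**: `ψ(L·y+ρ)·symLinAvgAt ρ T L μ y − symLinAvgAt ρ (fun a x ↦ ψ x·T a x) L μ y
= Σ_{x∈nearBox L y} Σ_α ((ψ(L·y+ρ) − ψ x)·count(α,x))·T α x`. -/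
theorem rootCommutator_eq_sum (hr : r ∈ box (d + 1) L) (ψ : Site (d + 1) → ℝ) (T : Form1 (d + 1) ℝ) (μ : Fin (d + 1)) (y : Site (d + 1)) :
    ψ ((L : ℤ) • y + toSite r) * symLinAvgAt (toSite r) T L μ y - symLinAvgAt (toSite r) (fun α x => ψ x * T α x) L μ y
      = ∑ x ∈ nearBox L y, ∑ α, ((ψ ((L : ℤ) • y + toSite r) - ψ x) * (symLinCountAt (toSite r) L μ y (α, x) : ℝ)) * T α x := by
  rw [symLinAvgAt_eq_sum_symLinCountAt hr T, symLinAvgAt_eq_sum_symLinCountAt hr, Finset.mul_sum, ← Finset.sum_sub_distrib]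
  refine Finset.sum_congr rfl fun x _ => ?_
  rw [Finset.mul_sum, ← Finset.sum_sub_distrib]
  refine Finset.sum_congr rfl fun α _ => ?_
  ring

/-- NOT IN PRINT; OUR BOOKKEEPING.  **THE TIP COMMUTATOR OF A STAIRCASE IS LOCALISED** (one step `L = Lc`, box root): with a finest-piece tip letter
`|G 0 (x+e_α) − G 0 (Lc·y+ρ+Lc·e_μ)| ≤ W` and a leg letter `|T α x| ≤ M` on `nearBox Lc y`,
`|symLinAvgAt ρ (fun κ u ↦ ψ(u+e_κ)·T κ u) Lc μ y − ψ(Lc·y+ρ+Lc·e_μ)·symLinAvgAt ρ T Lc μ y| ≤ (W + J(μ,y))·M·Σ_{x∈nearBox} Σ_α |count(α,x)|`. -/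
theorem abs_tipCommutator_le_of_staircase_of_le (hLc : 1 ≤ Lc) (hrr : rr ∈ box (d + 1) Lc) (G : ℕ → Site (d + 1) → ℝ) (n : ℕ)
    {ψ : Site (d + 1) → ℝ} (hψ : ∀ u, ψ u = ∑ s ∈ Finset.range (n + 1), G s (blk (Lc ^ s) u)) (T : Form1 (d + 1) ℝ) (μ : Fin (d + 1)) (y : Site (d + 1))
    {W M : ℝ} (hW : ∀ α, ∀ x ∈ nearBox Lc y, |G 0 (x + unitVec α) - G 0 ((Lc : ℤ) • y + toSite rr + (Lc : ℤ) • unitVec μ)| ≤ W)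
    (hT : ∀ α, ∀ x ∈ nearBox Lc y, |T α x| ≤ M) :
    |symLinAvgAt (toSite rr) (fun α x => ψ (x + unitVec α) * T α x) Lc μ y
        - ψ ((Lc : ℤ) • y + toSite rr + (Lc : ℤ) • unitVec μ) * symLinAvgAt (toSite rr) T Lc μ y|
      ≤ (W + ∑ s ∈ Finset.range n, |G (s + 1) (blk (Lc ^ s) (y + unitVec μ)) - G (s + 1) (blk (Lc ^ s) y)|) * M
          * ∑ x ∈ nearBox Lc y, ∑ α, |(symLinCountAt (toSite rr) Lc μ y (α, x) : ℝ)| := by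
  rw [tipCommutator_eq_sum hrr, Finset.mul_sum]
  refine (Finset.abs_sum_le_sum_abs _ _).trans (Finset.sum_le_sum fun x hx => ?_)
  rw [Finset.mul_sum]
  refine (Finset.abs_sum_le_sum_abs _ _).trans (Finset.sum_le_sum fun α _ => ?_)
  have hJ : 0 ≤ ∑ s ∈ Finset.range n, |G (s + 1) (blk (Lc ^ s) (y + unitVec μ)) - G (s + 1) (blk (Lc ^ s) y)| :=
    Finset.sum_nonneg fun _ _ => abs_nonneg _
  have h1 := hW α x hx
  have h2 := hT α x hx
  have hW0 : 0 ≤ W := (abs_nonneg _).trans h1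
  have hq := abs_nonneg (symLinCountAt (toSite rr) Lc μ y (α, x) : ℝ)
  have hloc := abs_tipWeight_staircase_mul_symLinCountAt_le hLc hrr G n hψ μ y α x
  rw [abs_mul]
  calc |(ψ (x + unitVec α) - ψ ((Lc : ℤ) • y + toSite rr + (Lc : ℤ) • unitVec μ)) * (symLinCountAt (toSite rr) Lc μ y (α, x) : ℝ)| * |T α x|
      ≤ ((W + ∑ s ∈ Finset.range n, |G (s + 1) (blk (Lc ^ s) (y + unitVec μ)) - G (s + 1) (blk (Lc ^ s) y)|)
          * |(symLinCountAt (toSite rr) Lc μ y (α, x) : ℝ)|) * M :=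
        mul_le_mul (hloc.trans (mul_le_mul_of_nonneg_right (by linarith) hq)) h2 (abs_nonneg _) (mul_nonneg (by linarith) hq)
    _ = (W + ∑ s ∈ Finset.range n, |G (s + 1) (blk (Lc ^ s) (y + unitVec μ)) - G (s + 1) (blk (Lc ^ s) y)|) * M
          * |(symLinCountAt (toSite rr) Lc μ y (α, x) : ℝ)| := by ring

/-- NOT IN PRINT; OUR BOOKKEEPING.  **THE ROOT COMMUTATOR OF A STAIRCASE IS LOCALISED** (one step `L = Lc`, box root): with `|G 0 (Lc·y+ρ) − G 0 x| ≤ W` and `|T α x| ≤ M` on `nearBox Lc y`,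
`|ψ(Lc·y+ρ)·symLinAvgAt ρ T Lc μ y − symLinAvgAt ρ (fun a x ↦ ψ x·T a x) Lc μ y| ≤ (W + J(μ,y))·M·Σ_{x∈nearBox} Σ_α |count(α,x)|`. -/
theorem abs_rootCommutator_le_of_staircase_of_le (hLc : 1 ≤ Lc) (hrr : rr ∈ box (d + 1) Lc) (G : ℕ → Site (d + 1) → ℝ) (n : ℕ)
    {ψ : Site (d + 1) → ℝ} (hψ : ∀ u, ψ u = ∑ s ∈ Finset.range (n + 1), G s (blk (Lc ^ s) u)) (T : Form1 (d + 1) ℝ) (μ : Fin (d + 1)) (y : Site (d + 1))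
    {W M : ℝ} (hW : ∀ x ∈ nearBox Lc y, |G 0 ((Lc : ℤ) • y + toSite rr) - G 0 x| ≤ W)
    (hT : ∀ α, ∀ x ∈ nearBox Lc y, |T α x| ≤ M) :
    |ψ ((Lc : ℤ) • y + toSite rr) * symLinAvgAt (toSite rr) T Lc μ y - symLinAvgAt (toSite rr) (fun α x => ψ x * T α x) Lc μ y|
      ≤ (W + ∑ s ∈ Finset.range n, |G (s + 1) (blk (Lc ^ s) (y + unitVec μ)) - G (s + 1) (blk (Lc ^ s) y)|) * M
          * ∑ x ∈ nearBox Lc y, ∑ α, |(symLinCountAt (toSite rr) Lc μ y (α, x) : ℝ)| := by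
  rw [rootCommutator_eq_sum hrr, Finset.mul_sum]
  refine (Finset.abs_sum_le_sum_abs _ _).trans (Finset.sum_le_sum fun x hx => ?_)
  rw [Finset.mul_sum]
  refine (Finset.abs_sum_le_sum_abs _ _).trans (Finset.sum_le_sum fun α _ => ?_)
  have hJ : 0 ≤ ∑ s ∈ Finset.range n, |G (s + 1) (blk (Lc ^ s) (y + unitVec μ)) - G (s + 1) (blk (Lc ^ s) y)| :=
    Finset.sum_nonneg fun _ _ => abs_nonneg _
  have h1 := hW x hx
  have h2 := hT α x hx
  have hW0 : 0 ≤ W := (abs_nonneg _).trans h1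
  have hq := abs_nonneg (symLinCountAt (toSite rr) Lc μ y (α, x) : ℝ)
  have hloc := abs_rootWeight_staircase_mul_symLinCountAt_le hLc hrr G n hψ μ y α x
  rw [abs_mul]
  calc |(ψ ((Lc : ℤ) • y + toSite rr) - ψ x) * (symLinCountAt (toSite rr) Lc μ y (α, x) : ℝ)| * |T α x|
      ≤ ((W + ∑ s ∈ Finset.range n, |G (s + 1) (blk (Lc ^ s) (y + unitVec μ)) - G (s + 1) (blk (Lc ^ s) y)|)
          * |(symLinCountAt (toSite rr) Lc μ y (α, x) : ℝ)|) * M :=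
        mul_le_mul (hloc.trans (mul_le_mul_of_nonneg_right (by linarith) hq)) h2 (abs_nonneg _) (mul_nonneg (by linarith) hq)
    _ = (W + ∑ s ∈ Finset.range n, |G (s + 1) (blk (Lc ^ s) (y + unitVec μ)) - G (s + 1) (blk (Lc ^ s) y)|) * M
          * |(symLinCountAt (toSite rr) Lc μ y (α, x) : ℝ)| := by ring

end Commutator

end Summit.QuantumFields.BalabanUV.Beta.GAN24.SymContactFaceJumpBorder

end
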